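import Literature.MathematicalPhysics.QuantumLattice.HubbardModel
import Literature.MathematicalPhysics.QuantumLattice.DWaveSource
import Literature.MathematicalPhysics.QuantumLattice.DWaveSourceProofs
import Literature.MathematicalPhysics.QuantumLattice.HubbardGrandCanonicalDensity
import Literature.MathematicalPhysics.QuantumLattice.GroundStateSourceBounds
import Literature.MathematicalPhysics.QuantumLattice.FinDimSpectrumProofs
import Literature.MathematicalPhysics.QuantumLattice.HubbardOneParticleCost
import HarnessLib

/-!
# Route `AposterioriCapRg` — crux `SsbToEvenTorusLro` (stmt-HubbardSuperconductivity-1315),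
# line `number-projected-canonical-slope`, dissection of stub (T): `stub_numberConcentrationOfVariance`

What is proved (`stub_numberConcentrationOfVariance`). Write `K_{μ'} = hubbardTorusWith 2 (L+1) 1 U μ'`,
`T_{h,μ'} = dWaveSourceTorus (L+1) U μ' h = K_{μ'} - h(P + Pᴴ)` (`P` the `d`-wave pair field), `N̂ = totalNumber`,
`V = (L+1)²`. Assume (DM) the tracial grand-canonical density `Re ω_{K_μ}(N̂)/V → 1 - δ`; (U) the energy density
`E₀(K_{μ'})/V → e(μ')` for `μ'` near `μ` with `e` differentiable at `μ`; (T-var) the unit ground vectors `φ` of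
`T_{h,μ}` have number VARIANCE `‖(N̂ - ν_φ)φ‖² ≤ εV²` (`ν_φ = Re⟨φ, N̂φ⟩`; eventually in `L`, for all small
`h > 0`). Then (T): `‖(N̂ - N_L)φ‖² ≤ εV²` in the same regime, `N_L = 2⌊(1-δ)V/2⌋`.

Proof. (1) Griffiths' lemma (`tendsto_gcDensity_of_hasDerivAt`) and uniqueness of limits give
`-e'(μ) = 1 - δ`. (2) `T_{h,μ'} = T_{h,μ} - (μ' - μ)N̂`, so the variational principle at a unit ground vector `φ`
of `T_{h,μ}` gives `E_h(μ') ≤ E_h(μ) - (μ' - μ)ν_φ` (`ncv_vector_slope`), i.e. the slope sandwich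
`(E_h(μ-η) - E_h(μ))/η ≤ ν_φ ≤ (E_h(μ) - E_h(μ+η))/η`. (3) Source removal `|E_h(μ') - E₀(K_{μ'})| ≤ C h V`
(variational chords with the tracial ground states, `|Re ω(O)| ≤ ‖O‖`, `‖P + Pᴴ‖ ≤ 2‖P‖ ≤ C V`;
`ncv_source_removal`). (4) Real analysis (`ncv_eventually_abs_slope_sub_lt`): for `η = η(ε)` from the derivative
and `L` large the unsourced slopes at `μ ± η` are within `εηV` of `e'ηV`; with `h₀ ≍ εη/C` this puts `ν_φ` within
`εV` of `(1-δ)V`, uniformly over ground vectors (`ncv_mean_near`). (5) `|N_L - (1-δ)V| ≤ 2` and `1 - δ ≥ 0` (limit of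
nonnegative densities). (6) Pythagoras `‖(N̂ - N_L)φ‖² = ‖(N̂ - ν_φ)φ‖² + (ν_φ - N_L)²` (the cross term vanishes as
`N̂` is Hermitian; `ncv_pythag`), and (T-var) at `ε/2` plus the mean bound give (T) at `ε`.

Sources: R. B. Griffiths, J. Math. Phys. 5 (1964) 1215 (Griffiths' lemma); T. Koma, H. Tasaki, J. Stat. Phys. 76
(1994) 745, §1 (sourced ground-state energies and their one-sided derivatives) — both used only through the tree
files `HubbardGrandCanonicalDensity`, `GroundStateSourceBounds`, `DWaveSourceProofs`, `FinDimSpectrumProofs`.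
Everything here is proved; no definition and no named fact is introduced. [folklore]
-/

noncomputable section

namespace Summit.HubbardSuperconductivity.HubbardSuperconductivity.Theorems

set_option linter.dupNamespace false

open Literature.MathematicalPhysics.QuantumLattice Literature.Probability.LatticeModels Matrix
open Filter Set
open scoped Matrix ComplexOrder ComplexConjugate Matrix.Norms.L2Operator Topology

/-! ### Real-analysis bookkeeping -/

-- adapted from `tendsto_of_slope_sandwich` of `Literature/.../HubbardGrandCanonicalDensity.lean`
/-- **Two-sided difference quotients of a pointwise limit near a differentiability point.** If
`f_L → F` pointwise near `x` and `F` is differentiable at `x` with derivative `F'`, then for every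
`ε > 0` there is `η > 0` such that, for all large `L`, both `f_L(x+η) - f_L(x)` and `f_L(x) - f_L(x-η)` are
within `εη` of `F'η` (the finite-`L` half of Griffiths' lemma, in `ε`-form so that it can be applied
uniformly to a family of sandwiched quantities). [folklore] -/
theorem ncv_eventually_abs_slope_sub_lt {f : ℕ → ℝ → ℝ} {F : ℝ → ℝ} {F' x : ℝ}
    (hlim : ∀ᶠ y in 𝓝 x, Tendsto (fun L => f L y) atTop (𝓝 (F y)))
    (hF : HasDerivAt F F' x) {ε : ℝ} (hε : 0 < ε) :
    ∃ η : ℝ, 0 < η ∧ ∀ᶠ L in atTop,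
      |f L (x + η) - f L x - F' * η| < ε * η ∧ |f L x - f L (x - η) - F' * η| < ε * η := by
  have hslope := hasDerivAt_iff_tendsto_slope.1 hF
  rw [Metric.tendsto_nhdsWithin_nhds] at hslope
  obtain ⟨r₁, hr₁, hs⟩ := hslope (ε / 2) (half_pos hε)
  obtain ⟨r₂, hr₂, hl⟩ := Metric.eventually_nhds_iff.1 hlim
  set η := min r₁ r₂ / 2 with hη_def
  have hη : 0 < η := by positivity
  have hη' : η ≠ 0 := hη.ne'
  have hηr₁ : η < r₁ := by
    have : min r₁ r₂ ≤ r₁ := min_le_left _ _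
    rw [hη_def]; linarith
  have hηr₂ : η < r₂ := by
    have : min r₁ r₂ ≤ r₂ := min_le_right _ _
    rw [hη_def]; linarith
  refine ⟨η, hη, ?_⟩
  have hx : Tendsto (fun L => f L x) atTop (𝓝 (F x)) := hl (by simpa using hr₂)
  have hdp : dist (x + η) x < r₂ := by
    rw [Real.dist_eq, add_sub_cancel_left, abs_of_pos hη]; exact hηr₂
  have hdm : dist (x - η) x < r₂ := by
    rw [Real.dist_eq, sub_sub_cancel_left, abs_neg, abs_of_pos hη]; exact hηr₂
  have hxp : Tendsto (fun L => f L (x + η)) atTop (𝓝 (F (x + η))) := hl hdp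
  have hxm : Tendsto (fun L => f L (x - η)) atTop (𝓝 (F (x - η))) := hl hdm
  have hup : Tendsto (fun L => f L (x + η) - f L x) atTop (𝓝 (F (x + η) - F x)) := hxp.sub hx
  have hlo : Tendsto (fun L => f L x - f L (x - η)) atTop (𝓝 (F x - F (x - η))) := hx.sub hxm
  have hs_up : |F (x + η) - F x - F' * η| < ε / 2 * η := by
    have h1 : x + η ∈ ({x}ᶜ : Set ℝ) := by simp [hη.ne']
    have h2 : dist (x + η) x < r₁ := by
      rw [Real.dist_eq, add_sub_cancel_left, abs_of_pos hη]; exact hηr₁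
    have := hs h1 h2
    rw [slope_def_field, add_sub_cancel_left, Real.dist_eq] at this
    have key : (F (x + η) - F x) / η - F' = (F (x + η) - F x - F' * η) / η := by
      field_simp
    rwa [key, abs_div, abs_of_pos hη, div_lt_iff₀ hη] at this
  have hs_lo : |F x - F (x - η) - F' * η| < ε / 2 * η := by
    have h1 : x - η ∈ ({x}ᶜ : Set ℝ) := by simp [hη.ne']
    have h2 : dist (x - η) x < r₁ := by
      rw [Real.dist_eq, sub_sub_cancel_left, abs_neg, abs_of_pos hη]; exact hηr₁
    have := hs h1 h2
    rw [slope_def_field, sub_sub_cancel_left, Real.dist_eq] at this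
    have key : (F (x - η) - F x) / -η - F' = (F x - F (x - η) - F' * η) / η := by
      field_simp
      ring
    rwa [key, abs_div, abs_of_pos hη, div_lt_iff₀ hη] at this
  have e_up := Metric.tendsto_nhds.1 hup (ε / 2 * η) (by positivity)
  have e_lo := Metric.tendsto_nhds.1 hlo (ε / 2 * η) (by positivity)
  filter_upwards [e_up, e_lo] with L hL1 hL2
  rw [Real.dist_eq, abs_sub_lt_iff] at hL1 hL2
  rw [abs_sub_lt_iff] at hs_up hs_lo
  obtain ⟨h1, h2⟩ := hL1
  obtain ⟨h3, h4⟩ := hL2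
  obtain ⟨h5, h6⟩ := hs_up
  obtain ⟨h7, h8⟩ := hs_lo
  constructor <;> rw [abs_sub_lt_iff] <;> constructor <;> linarith

/-- Clearing a positive denominator: `|p/V - q/V - r| < s ⇒ |p - q - rV| < sV`. [folklore] -/
theorem ncv_abs_div_sub_div_lt {p q V r s : ℝ} (hV : 0 < V) (h : |p / V - q / V - r| < s) :
    |p - q - r * V| < s * V := by
  have key : p / V - q / V - r = (p - q - r * V) / V := by
    field_simp
  rwa [key, abs_div, abs_of_pos hV, div_lt_iff₀ hV] at h

/-- **The sandwich arithmetic.** If `B ≤ A - ην`, `Cm ≤ A + ην` (variational slopes), `A, B, Cm` are within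
`k` of `a, b, c` (source removal), `4k ≤ εηV`, and the unsourced increments `b - a`, `a - c` are within
`(ε/2)ηV` of `e'ηV`, then `|ν + e'V| ≤ εV`. [folklore] -/
theorem ncv_sandwich_arith {ν a b c A B Cm V η e' ε k : ℝ} (hη : 0 < η)
    (v1 : B ≤ A - η * ν) (v2 : Cm ≤ A + η * ν)
    (s1 : |A - a| ≤ k) (s2 : |B - b| ≤ k) (s3 : |Cm - c| ≤ k)
    (hk : 4 * k ≤ ε * η * V)
    (hup : |b - a - e' * η * V| < ε / 2 * η * V) (hlo : |a - c - e' * η * V| < ε / 2 * η * V) :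
    |ν + e' * V| ≤ ε * V := by
  rw [abs_le] at s1 s2 s3 ⊢
  rw [abs_sub_lt_iff] at hup hlo
  obtain ⟨s1a, s1b⟩ := s1
  obtain ⟨s2a, s2b⟩ := s2
  obtain ⟨s3a, s3b⟩ := s3
  obtain ⟨hu1, hu2⟩ := hup
  obtain ⟨hl1, hl2⟩ := hlo
  constructor
  · have h : η * (-(ε * V)) ≤ η * (ν + e' * V) := by linarith
    exact le_of_mul_le_mul_left h hη
  · have h : η * (ν + e' * V) ≤ η * (ε * V) := by linarith
    exact le_of_mul_le_mul_left h hη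

/-- **Pythagoras for the variance split.** For a unit vector `φ`, a vector `a` with `Re⟨a, φ⟩ = 0` and a real
`c`: `‖a + cφ‖² = ‖a‖² + c²`. [folklore] -/
theorem ncv_pythag {m : Type*} [Fintype m] {a φ : m → ℂ} (h1 : star φ ⬝ᵥ φ = 1)
    (h0 : (star a ⬝ᵥ φ).re = 0) (c : ℝ) :
    (star (a + (c : ℂ) • φ) ⬝ᵥ (a + (c : ℂ) • φ)).re = (star a ⬝ᵥ a).re + c ^ 2 := by
  have h0' : (star φ ⬝ᵥ a).re = 0 := by
    rw [star_dotProduct, Complex.star_def, Complex.conj_re, h0]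
  simp only [star_add, star_smul, add_dotProduct, dotProduct_add, smul_dotProduct, dotProduct_smul, h1,
    Complex.star_def, Complex.conj_ofReal, smul_eq_mul, mul_one, Complex.add_re, h0, h0', Complex.mul_re,
    Complex.ofReal_re, Complex.ofReal_im]
  ring

/-! ### The two variational inputs: vector-state slopes and source removal -/

/-- **Vector-state slope inequality.** `T_{h,μ'} = T_{h,μ} - (μ' - μ)N̂`, so for a unit ground vector `φ` of
`T_{h,μ} = dWaveSourceTorus L U μ h` the variational principle for `T_{h,μ'}` gives
`E₀(T_{h,μ'}) ≤ E₀(T_{h,μ}) - (μ' - μ) Re⟨φ, N̂φ⟩`. [cite: KomaTasaki1994, §1] -/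
theorem ncv_vector_slope (L : ℕ) [NeZero L] (U μ μ' h : ℝ) {φ : Fock (Orb (FermionTorus 2 L))}
    (hφ : (dWaveSourceTorus L U μ h).IsGroundStateVector φ) (h1 : star φ ⬝ᵥ φ = 1) :
    (dWaveSourceTorus L U μ' h).groundEnergy ≤
      (dWaveSourceTorus L U μ h).groundEnergy - (μ' - μ) * (star φ ⬝ᵥ (totalNumber *ᵥ φ)).re := by
  have hT : dWaveSourceTorus L U μ' h =
      dWaveSourceTorus L U μ h - ((μ' - μ : ℝ) : ℂ) • totalNumber := by
    rw [dWaveSourceTorus_eq, dWaveSourceTorus_eq, hubbardTorusWith_eq, hubbardTorusWith_eq,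
      Complex.ofReal_sub, sub_smul]
    abel
  have hH := dWaveSourceTorus_isHermitian L (isHermitian_hubbardTorusWith L 1 U μ') h
  have key := groundEnergy_le_rayleigh_holds hH φ h1
  have hmv : dWaveSourceTorus L U μ' h *ᵥ φ =
      ((dWaveSourceTorus L U μ h).groundEnergy : ℂ) • φ -
        ((μ' - μ : ℝ) : ℂ) • (totalNumber *ᵥ φ) := by
    rw [hT, sub_mulVec, smul_mulVec, hφ.2]
  rw [hmv, dotProduct_sub, dotProduct_smul, dotProduct_smul, h1, smul_eq_mul, mul_one, smul_eq_mul,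
    Complex.sub_re, Complex.ofReal_re, Complex.re_ofReal_mul] at key
  exact key

-- adapted from `abs_groundEnergy_sub_smul_sub_le` (private) of
-- `Theorems/ChiralWindowCwSsbToEvenTorusLROSourceRemoval.lean`
/-- Source removal for the ground energy, abstract form: for Hermitian `A`, `O` and real `h`,
`|E₀(A - hO) - E₀(A)| ≤ |h| ‖O‖` (operator norm) — the two variational chords with the tracial ground
states of `A` and of `A - hO`, and `|Re ω(O)| ≤ ‖O‖`. [folklore] -/
theorem ncv_abs_groundEnergy_sub_smul_sub_le {n : Type*} [Fintype n] [DecidableEq n] [Nonempty n]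
    {A O : Matrix n n ℂ} (hA : A.IsHermitian) (hO : O.IsHermitian) (h : ℝ) :
    |(A - (h : ℂ) • O).groundEnergy - A.groundEnergy| ≤ |h| * ‖O‖ := by
  have h1 := sub_mul_re_groundStateFunctional_le hA hO 0 h
  have h2 := sub_mul_re_groundStateFunctional_le hA hO h 0
  simp only [Complex.ofReal_zero, zero_smul, sub_zero, zero_sub, neg_mul] at h1 h2
  have hb : ∀ {B : Matrix n n ℂ}, B.IsHermitian →
      |h * (B.groundStateFunctional O).re| ≤ |h| * ‖O‖ := fun hB => by
    rw [abs_mul]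
    exact mul_le_mul_of_nonneg_left (abs_re_groundStateFunctional_le_norm hB O) (abs_nonneg h)
  have c1 := hb hA
  have c2 := hb (isHermitian_sub_real_smul hA hO h)
  rw [abs_le] at c1 c2 ⊢
  constructor <;> linarith [c1.1, c1.2, c2.1, c2.2]

/-- **Source removal on the torus, uniformly in the side.** There is `C ≥ 0` (namely `2‖P‖/L² ≤ 4Σ_e|d(e)/√2|`)
with `|E₀(dWaveSourceTorus L U μ h) - E₀(hubbardTorusWith 2 L 1 U μ)| ≤ C |h| L²` for every `L ≥ 1` and all
`U, μ, h`. [cite: KomaTasaki1994, §1] -/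
theorem ncv_source_removal : ∃ C : ℝ, 0 ≤ C ∧ ∀ (L : ℕ) [NeZero L] (U μ h : ℝ),
    |(dWaveSourceTorus L U μ h).groundEnergy - (hubbardTorusWith 2 L 1 U μ).groundEnergy| ≤
      C * |h| * (L : ℝ) ^ 2 := by
  refine ⟨2 * (2 * ∑ e ∈ insert (0 : Site 2) unitSteps, |dWaveFormFactor e / Real.sqrt 2|),
    by positivity, fun L _ U μ h => ?_⟩
  have hA := isHermitian_hubbardTorusWith L 1 U μ
  have hO := isHermitian_pairField_add_conjTranspose L
  have hP := norm_pairField_le dWaveFormFactor L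
  rw [dWaveSourceTorus_eq]
  refine (ncv_abs_groundEnergy_sub_smul_sub_le hA hO h).trans ?_
  calc |h| * ‖pairField dWaveFormFactor L + (pairField dWaveFormFactor L)ᴴ‖
      ≤ |h| * (‖pairField dWaveFormFactor L‖ + ‖(pairField dWaveFormFactor L)ᴴ‖) :=
        mul_le_mul_of_nonneg_left (norm_add_le _ _) (abs_nonneg h)
    _ = |h| * (2 * ‖pairField dWaveFormFactor L‖) := by rw [l2_opNorm_conjTranspose]; ring
    _ ≤ |h| * (2 * ((2 * ∑ e ∈ insert (0 : Site 2) unitSteps, |dWaveFormFactor e / Real.sqrt 2|) *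
          (L : ℝ) ^ 2)) := by gcongr
    _ = 2 * (2 * ∑ e ∈ insert (0 : Site 2) unitSteps, |dWaveFormFactor e / Real.sqrt 2|) * |h| *
          (L : ℝ) ^ 2 := by ring

/-! ### The mean particle number of sourced ground vectors -/

/-- **Mean density of sourced ground vectors (uniform Griffiths bound).** If `E₀(K_{μ'})/(L+1)² → e(μ')` for
`μ'` near `μ` and `e` has derivative `e'` at `μ`, then for every `ε > 0` there is `h₀ > 0` such that for all
`h ∈ (0, h₀)`, eventually in `L`, EVERY unit ground vector `φ` of `dWaveSourceTorus (L+1) U μ h` has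
`|Re⟨φ, N̂φ⟩ + e'(L+1)²| ≤ ε(L+1)²` (vector-state slope sandwich + source removal + the derivative).
[cite: KomaTasaki1994, §1] -/
theorem ncv_mean_near (U μ : ℝ) {e : ℝ → ℝ} {e' : ℝ}
    (hlim : ∀ᶠ μ' in 𝓝 μ, Tendsto (fun L : ℕ =>
      (hubbardTorusWith 2 (L + 1) 1 U μ').groundEnergy / ((L + 1 : ℕ) : ℝ) ^ 2) atTop (𝓝 (e μ')))
    (hder : HasDerivAt e e' μ) {ε : ℝ} (hε : 0 < ε) :
    ∃ h₀ : ℝ, 0 < h₀ ∧ ∀ h ∈ Set.Ioo (0:ℝ) h₀, ∀ᶠ L : ℕ in atTop,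
      ∀ φ : Fock (Orb (FermionTorus 2 (L + 1))),
        (dWaveSourceTorus (L + 1) U μ h).IsGroundStateVector φ → star φ ⬝ᵥ φ = 1 →
        |(star φ ⬝ᵥ (totalNumber *ᵥ φ)).re + e' * ((L + 1 : ℕ) : ℝ) ^ 2| ≤
          ε * ((L + 1 : ℕ) : ℝ) ^ 2 := by
  obtain ⟨C, hC0, hC⟩ := ncv_source_removal
  obtain ⟨η, hη, hev⟩ := ncv_eventually_abs_slope_sub_lt
    (f := fun (L : ℕ) (y : ℝ) => (hubbardTorusWith 2 (L + 1) 1 U y).groundEnergy / ((L + 1 : ℕ) : ℝ) ^ 2)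
    (F := e) hlim hder (half_pos hε)
  refine ⟨ε * η / (4 * (C + 1)), by positivity, fun h hh => ?_⟩
  filter_upwards [hev] with L hL φ hφ h1
  obtain ⟨hup, hlo⟩ := hL
  have hV : (0 : ℝ) < ((L + 1 : ℕ) : ℝ) ^ 2 := by positivity
  have hup' := ncv_abs_div_sub_div_lt hV hup
  have hlo' := ncv_abs_div_sub_div_lt hV hlo
  have v1 := ncv_vector_slope (L + 1) U μ (μ + η) h hφ h1
  have v2 := ncv_vector_slope (L + 1) U μ (μ - η) h hφ h1
  rw [add_sub_cancel_left] at v1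
  rw [sub_sub_cancel_left, neg_mul, sub_neg_eq_add] at v2
  have s1 := hC (L + 1) U μ h
  have s2 := hC (L + 1) U (μ + η) h
  have s3 := hC (L + 1) U (μ - η) h
  have hk : 4 * (C * |h| * ((L + 1 : ℕ) : ℝ) ^ 2) ≤ ε * η * ((L + 1 : ℕ) : ℝ) ^ 2 := by
    rw [abs_of_pos hh.1]
    have h1' : C * h ≤ (C + 1) * h := by nlinarith [hh.1]
    have h2' : (C + 1) * h ≤ (C + 1) * (ε * η / (4 * (C + 1))) :=
      mul_le_mul_of_nonneg_left hh.2.le (by positivity)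
    have h3' : (C + 1) * (ε * η / (4 * (C + 1))) = ε * η / 4 := by
      field_simp
    have h4' : C * h ≤ ε * η / 4 := by linarith
    have h5' := mul_le_mul_of_nonneg_right h4' hV.le
    linarith
  exact ncv_sandwich_arith hη v1 v2 s1 s2 s3 hk hup' hlo'

/-- **(T-dissection) `stub_numberConcentrationOfVariance`** — the alignment stub (T) of line number-projected-canonical-slope
REDUCED to its two honest halves: (U) the grand-canonical ground-state energy density `e(μ') = lim E₀(K_{μ'})/L²` (it exists,
landed `stub_torusGcEnergyDensityLimit`) is DIFFERENTIABLE at `μ` ("no density jump at `μ`"), and (T-var) the unit ground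
vectors of the SOURCED torus have particle-number VARIANCE `o(L⁴)` (`L → ∞` at fixed small `h`, then `h → 0⁺`). Under
density matching at `μ`, (U) ∧ (T-var) ⇒ (T): Griffiths' lemma identifies `−e'(μ) = 1 − δ`
(`tendsto_gcDensity_of_hasDerivAt`); the vector-state slope sandwich
`(E_h(μ−η) − E_h(μ))/η ≤ ⟨N̂⟩_φ ≤ (E_h(μ) − E_h(μ+η))/η` for ground vectors of `T_{h,μ} = K_μ − h(P+Pᴴ)`
(`T_{h,μ±η} = T_{h,μ} ∓ ηN̂`, variational principle) and source removal `|E_h(μ') − E₀(K_{μ'})| ≤ 2h‖P+Pᴴ‖ ≤ C h L²`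
put `⟨N̂⟩_φ/L²` within `o(1)` of `1 − δ` as `L → ∞` then `h → 0` (take `η = η(ε)` from the derivative, `h₀ ≪ η√ε`);
finally `‖(N̂ − N)φ‖² = ‖(N̂ − ⟨N̂⟩)φ‖² + (⟨N̂⟩ − N)²` and `|N_L − (1−δ)L²| ≤ 2`. PROVABLE NOW (real analysis + two
variational inequalities). [folklore] -/
theorem stub_numberConcentrationOfVariance :
    ∀ (U δ μ : ℝ),
      Filter.Tendsto (fun L : ℕ => ((hubbardTorusWith 2 (L + 1) 1 U μ).groundStateFunctional totalNumber).re / ((L + 1 : ℕ) : ℝ) ^ 2) Filter.atTop (nhds (1 - δ)) →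
      (∃ e : ℝ → ℝ, (∀ᶠ μ' in nhds μ, Filter.Tendsto (fun L : ℕ => (hubbardTorusWith 2 (L + 1) 1 U μ').groundEnergy / ((L + 1 : ℕ) : ℝ) ^ 2) Filter.atTop (nhds (e μ'))) ∧ DifferentiableAt ℝ e μ) →
      (∀ ε : ℝ, 0 < ε → ∃ h₀ : ℝ, 0 < h₀ ∧ ∀ h ∈ Set.Ioo (0:ℝ) h₀, ∀ᶠ L : ℕ in Filter.atTop,
        ∀ φ : Fock (Orb (FermionTorus 2 (L + 1))), (dWaveSourceTorus (L + 1) U μ h).IsGroundStateVector φ →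
          star φ ⬝ᵥ φ = 1 →
          (star (totalNumber *ᵥ φ - (((star φ ⬝ᵥ (totalNumber *ᵥ φ)).re : ℝ) : ℂ) • φ) ⬝ᵥ
              (totalNumber *ᵥ φ - (((star φ ⬝ᵥ (totalNumber *ᵥ φ)).re : ℝ) : ℂ) • φ)).re ≤
            ε * ((L + 1 : ℕ) : ℝ) ^ 4) →
      ∀ ε : ℝ, 0 < ε → ∃ h₀ : ℝ, 0 < h₀ ∧ ∀ h ∈ Set.Ioo (0:ℝ) h₀, ∀ᶠ L : ℕ in Filter.atTop,
        ∀ φ : Fock (Orb (FermionTorus 2 (L + 1))), (dWaveSourceTorus (L + 1) U μ h).IsGroundStateVector φ →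
          star φ ⬝ᵥ φ = 1 →
          (star (totalNumber *ᵥ φ - ((2 * ⌊(1 - δ) * ((L + 1 : ℕ) : ℝ) ^ 2 / 2⌋₊ : ℕ) : ℂ) • φ) ⬝ᵥ
              (totalNumber *ᵥ φ - ((2 * ⌊(1 - δ) * ((L + 1 : ℕ) : ℝ) ^ 2 / 2⌋₊ : ℕ) : ℂ) • φ)).re ≤
            ε * ((L + 1 : ℕ) : ℝ) ^ 4 := by
  intro U δ μ hDM hU hTvar ε hε
  obtain ⟨e, hlim, hdiff⟩ := hU
  have hder : HasDerivAt e (deriv e μ) μ := hdiff.hasDerivAt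
  have he' : -deriv e μ = 1 - δ :=
    tendsto_nhds_unique (tendsto_gcDensity_of_hasDerivAt 1 U μ hlim hder) hDM
  have hδ : 0 ≤ 1 - δ :=
    ge_of_tendsto' hDM fun L => (gcDensity_torus_mem_Icc (L + 1) 1 U μ).1
  set τ := min ε 1 with hτ_def
  have hτ0 : 0 < τ := lt_min hε one_pos
  have hτε : τ ≤ ε := min_le_left _ _
  have hτ1 : τ ≤ 1 := min_le_right _ _
  obtain ⟨h₁, hh₁, H1⟩ := hTvar (ε / 2) (half_pos hε)
  obtain ⟨h₂, hh₂, H2⟩ := ncv_mean_near U μ hlim hder (ε := τ / 4) (by positivity)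
  refine ⟨min h₁ h₂, lt_min hh₁ hh₂, fun h hh => ?_⟩
  have hhI1 : h ∈ Set.Ioo 0 h₁ := ⟨hh.1, lt_of_lt_of_le hh.2 (min_le_left _ _)⟩
  have hhI2 : h ∈ Set.Ioo 0 h₂ := ⟨hh.1, lt_of_lt_of_le hh.2 (min_le_right _ _)⟩
  have hlarge : ∀ᶠ L : ℕ in atTop, 8 / τ ≤ ((L + 1 : ℕ) : ℝ) ^ 2 := by
    refine eventually_atTop.2 ⟨⌈8 / τ⌉₊, fun L hL => ?_⟩
    have h1 : (8 / τ : ℝ) ≤ (⌈8 / τ⌉₊ : ℝ) := Nat.le_ceil _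
    have h2 : ((⌈8 / τ⌉₊ : ℕ) : ℝ) ≤ (L : ℝ) := Nat.cast_le.2 hL
    have h3 : ((L + 1 : ℕ) : ℝ) = (L : ℝ) + 1 := by push_cast; ring
    have h4 : (0 : ℝ) ≤ (L : ℝ) := Nat.cast_nonneg L
    rw [h3]
    nlinarith
  filter_upwards [H1 h hhI1, H2 h hhI2, hlarge] with L hL1 hL2 hL3 φ hφ h1
  have hVar := hL1 φ hφ h1
  have hMean := hL2 φ hφ h1
  clear hL1 hL2
  set V := ((L + 1 : ℕ) : ℝ) ^ 2 with hV_def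
  have hV : 0 < V := by positivity
  have hV4 : ((L + 1 : ℕ) : ℝ) ^ 4 = V ^ 2 := by rw [hV_def]; ring
  set NL : ℕ := 2 * ⌊(1 - δ) * V / 2⌋₊ with hNL_def
  obtain ⟨ν, hν⟩ : ∃ ν : ℝ, (star φ ⬝ᵥ (totalNumber *ᵥ φ)).re = ν := ⟨_, rfl⟩
  rw [hν] at hVar hMean
  -- the mean is close to `(1 - δ) V`
  have hMean' : |ν - (1 - δ) * V| ≤ τ / 4 * V := by
    have : ν - (1 - δ) * V = ν + deriv e μ * V := by rw [← he']; ring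
    rwa [this]
  -- the sector particle number is close to `(1 - δ) V`
  have hfl : |(NL : ℝ) - (1 - δ) * V| ≤ 2 := by
    have hx : 0 ≤ (1 - δ) * V / 2 := div_nonneg (mul_nonneg hδ hV.le) zero_le_two
    have hf1 := Nat.floor_le hx
    have hf2 := Nat.lt_floor_add_one ((1 - δ) * V / 2)
    rw [hNL_def]
    push_cast
    rw [abs_le]
    constructor <;> linarith
  have h8 : 8 ≤ V * τ := (div_le_iff₀ hτ0).1 hL3
  have hd : |ν - (NL : ℝ)| ≤ τ / 2 * V := by
    rw [abs_le] at hMean' hfl ⊢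
    obtain ⟨m1, m2⟩ := hMean'
    obtain ⟨f1, f2⟩ := hfl
    constructor <;> linarith
  have hsq : (ν - (NL : ℝ)) ^ 2 ≤ ε / 4 * V ^ 2 := by
    have h1' : (ν - (NL : ℝ)) ^ 2 ≤ (τ / 2 * V) ^ 2 := by
      rw [← sq_abs]
      exact pow_le_pow_left₀ (abs_nonneg _) hd 2
    have h2' : τ ^ 2 ≤ ε :=
      calc τ ^ 2 = τ * τ := sq τ
        _ ≤ 1 * τ := mul_le_mul_of_nonneg_right hτ1 hτ0.le
        _ = τ := one_mul τ
        _ ≤ ε := hτε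
    calc (ν - (NL : ℝ)) ^ 2 ≤ (τ / 2 * V) ^ 2 := h1'
      _ = τ ^ 2 * V ^ 2 / 4 := by ring
      _ ≤ ε * V ^ 2 / 4 := by gcongr
      _ = ε / 4 * V ^ 2 := by ring
  -- Pythagoras
  have h0 : (star (totalNumber *ᵥ φ - (ν : ℂ) • φ) ⬝ᵥ φ).re = 0 := by
    rw [star_sub, star_smul, sub_dotProduct, smul_dotProduct, h1,
      ThermodynamicLimit.star_mulVec_dotProduct, totalNumber_isHermitian.eq]
    simp only [Complex.star_def, Complex.conj_ofReal, smul_eq_mul, mul_one, Complex.sub_re,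
      Complex.ofReal_re, hν, sub_self]
  have hsplit : totalNumber *ᵥ φ - ((NL : ℕ) : ℂ) • φ =
      (totalNumber *ᵥ φ - (ν : ℂ) • φ) + ((ν - NL : ℝ) : ℂ) • φ := by
    rw [Complex.ofReal_sub, Complex.ofReal_natCast, sub_smul]
    abel
  rw [hsplit, ncv_pythag h1 h0, hV4]
  rw [hV4] at hVar
  have hεV : 0 ≤ ε * V ^ 2 := by positivity
  generalize (star (totalNumber *ᵥ φ - (ν : ℂ) • φ) ⬝ᵥ (totalNumber *ᵥ φ - (ν : ℂ) • φ)).re = X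
    at hVar ⊢
  linarith

end Summit.HubbardSuperconductivity.HubbardSuperconductivity.Theorems

end
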